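import Summits.HodgeConjecture.HodgeCM.Literature.GaoUllmo_1

/-! PORT of `HodgeCM/Literature/GaoUllmo.lean` (HodgeCMPerL run 81) — part 2: continuation of `Summits.HodgeConjecture.HodgeCM.Literature.GaoUllmo_1` (split at a top-level declaration boundary by port_pkg.py; scope re-opened below; declarations unchanged). -/

-- port_pkg: scope re-opened for this part (file-level context, then the namespace/section stack open at the cut)
noncomputable section
open Module
attribute [local instance] Classical.propDecidable
namespace HodgeCM
namespace GaoUllmo
section API
variable {E : Type} [CommRing E] [Algebra ℚ E] [Module.Finite ℚ E]
variable (g : ℕ)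

/-- The `φ_j`-coordinate of `rec^*(ε_I)` is `1` if `j ∉ I` and `0` otherwise; the `φ̄_j`-coordinate is `1` if `j ∈ I`
and `0` otherwise (Prop 4.5 read coordinatewise). -/
theorem recStar_eps_apply (I : Finset (Fin g)) (j : Fin g) (b : Bool) :
    recStar g (eps g I) (j, b) = if (j ∈ I ↔ b) then 1 else 0 := by
  rw [recStar_eps, Finsupp.add_apply, Finsupp.coe_finsetSum, Finsupp.coe_finsetSum, Finset.sum_apply,
    Finset.sum_apply]
  simp only [phi, phibar, Finsupp.single_apply, Prod.mk.injEq]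
  cases b <;> simp [Finset.sum_ite_eq', Finset.mem_filter]

/-- **Easy half of Proposition 5.1** ("By Proposition 4.5, each such `ε_I + ε_J − ε_K − ε_L` is in `N'`", chunk p0019 L34):
the quadrilateral relations lie in the kernel of `rec^*`. -/
theorem quadRel_le_Nprime : quadRel g ≤ Nprime g := by
  rw [quadRel, Submodule.span_le]
  rintro x ⟨I, J, K, L, h1, h2, rfl⟩
  simp only [Nprime, SetLike.mem_coe, LinearMap.mem_ker, map_sub, map_add]
  ext ⟨j, b⟩
  simp only [Finsupp.coe_sub, Finsupp.coe_add, Pi.sub_apply, Pi.add_apply, recStar_eps_apply, Finsupp.coe_zero,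
    Pi.zero_apply]
  have hI : (j ∈ I ∧ j ∈ J) ↔ (j ∈ K ∧ j ∈ L) := by
    rw [← Finset.mem_inter, ← Finset.mem_inter, h1]
  have hU : (j ∈ I ∨ j ∈ J) ↔ (j ∈ K ∨ j ∈ L) := by
    rw [← Finset.mem_union, ← Finset.mem_union, h2]
  by_cases hi : j ∈ I <;> by_cases hj : j ∈ J <;> by_cases hk : j ∈ K <;> by_cases hl : j ∈ L <;>
    cases b <;> simp_all

end API

/-! ### Proof of Proposition 5.1 (kernel-proved here; the paper's Lemma 5.3 + the induction behind Lemma 5.5) -/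

section Prop51Proof

variable (g : ℕ)

/-- `M = ℤε_∅ ⊕ ⊕_j ℤε_{{j}}` (Lemma 5.3, art. p. 16, chunk p0018 L45, as the range of the parametrisation
`(k₀, k) ↦ k₀ ε_∅ + Σ_j k_j ε_{{j}}`. -/
def mkM : (ℤ × (Fin g → ℤ)) →ₗ[ℤ] XStar g :=
  (LinearMap.fst ℤ ℤ (Fin g → ℤ)).smulRight (eps g ∅) +
    ∑ j : Fin g, ((LinearMap.proj j).comp (LinearMap.snd ℤ ℤ (Fin g → ℤ))).smulRight (eps g {j})

/-- (Ported verbatim from the HodgeCMPerL package; no docstring in the source.) -/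
theorem mkM_apply (k : ℤ × (Fin g → ℤ)) :
    mkM g k = k.1 • eps g ∅ + ∑ j : Fin g, k.2 j • eps g {j} := by
  simp [mkM, LinearMap.sum_apply]

/-- The `φ̄_i`-coordinate of `rec^*(k₀ ε_∅ + Σ k_j ε_{{j}})` is `k_i`. -/
theorem recStar_mkM_apply_true (k : ℤ × (Fin g → ℤ)) (i : Fin g) :
    recStar g (mkM g k) (i, true) = k.2 i := by
  rw [mkM_apply, map_add, map_smul, map_sum, Finsupp.add_apply, Finsupp.smul_apply, Finsupp.coe_finsetSum,
    Finset.sum_apply, recStar_eps_apply]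
  simp only [Finset.notMem_empty, map_smul, Finsupp.smul_apply, recStar_eps_apply, Finset.mem_singleton,
    smul_eq_mul]
  simp [Finset.sum_ite_eq]

/-- The `φ_i`-coordinate of `rec^*(k₀ ε_∅ + Σ k_j ε_{{j}})` is `k₀ + Σ_{j ≠ i} k_j`. -/
theorem recStar_mkM_apply_false (k : ℤ × (Fin g → ℤ)) (i : Fin g) :
    recStar g (mkM g k) (i, false) = k.1 + ∑ j : Fin g, if i = j then 0 else k.2 j := by
  rw [mkM_apply, map_add, map_smul, map_sum, Finsupp.add_apply, Finsupp.smul_apply, Finsupp.coe_finsetSum,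
    Finset.sum_apply, recStar_eps_apply]
  simp only [Finset.notMem_empty, map_smul, Finsupp.smul_apply, recStar_eps_apply, Finset.mem_singleton,
    smul_eq_mul]
  simp only [false_iff, mul_one, mul_ite, mul_zero]
  congr 1
  refine Finset.sum_congr rfl fun j _ => ?_
  by_cases h : i = j <;> simp [h]

/-- Lemma 5.3 (art. p. 16): `M ∩ N' = 0`, i.e. `rec^*` is injective on `M` (for `g ≥ 1`). -/
theorem mkM_eq_zero_of_recStar_eq_zero (hg : 0 < g) (k : ℤ × (Fin g → ℤ)) (h : recStar g (mkM g k) = 0) :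
    k = 0 := by
  have h2 : k.2 = 0 := by
    funext i
    have := recStar_mkM_apply_true g k i
    rw [h, Finsupp.zero_apply] at this
    exact this.symm
  have h1 : k.1 = 0 := by
    have := recStar_mkM_apply_false g k ⟨0, hg⟩
    rw [h, Finsupp.zero_apply, h2] at this
    simpa [eq_comm] using this
  exact Prod.ext h1 h2

/-- The induction behind Lemma 5.5: every `ε_I` lies in `M + N₁` — `ε_I = (ε_I + ε_∅ − ε_{I∖{i}} − ε_{{i}}) + ε_{I∖{i}} + ε_{{i}} − ε_∅`. -/
theorem eps_mem_range_mkM_sup_quadRel (I : Finset (Fin g)) :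
    eps g I ∈ LinearMap.range (mkM g) ⊔ quadRel g := by
  induction I using Finset.induction_on with
  | empty =>
    apply Submodule.mem_sup_left
    exact ⟨(1, 0), by simp [mkM_apply]⟩
  | insert i I hi ih =>
    have hsingle : eps g {i} ∈ LinearMap.range (mkM g) ⊔ quadRel g := by
      apply Submodule.mem_sup_left
      refine ⟨(0, Pi.single i 1), ?_⟩
      rw [mkM_apply]
      simp [Pi.single_apply, Finset.sum_ite_eq']
    have hempty : eps g ∅ ∈ LinearMap.range (mkM g) ⊔ quadRel g :=
      Submodule.mem_sup_left ⟨(1, 0), by simp [mkM_apply]⟩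
    have hquad : eps g (insert i I) + eps g ∅ - eps g I - eps g {i} ∈ LinearMap.range (mkM g) ⊔ quadRel g := by
      apply Submodule.mem_sup_right
      apply Submodule.subset_span
      refine ⟨insert i I, ∅, I, {i}, ?_, ?_, rfl⟩
      · rw [Finset.inter_empty, Finset.inter_singleton_of_notMem hi]
      · rw [Finset.union_empty, Finset.union_comm, ← Finset.insert_eq]
    have : eps g (insert i I) =
        (eps g (insert i I) + eps g ∅ - eps g I - eps g {i}) + eps g I + eps g {i} - eps g ∅ := by abel
    rw [this]
    exact Submodule.sub_mem _ (Submodule.add_mem _ (Submodule.add_mem _ hquad ih) hsingle) hempty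

/-- (Ported verbatim from the HodgeCMPerL package; no docstring in the source.) -/
theorem top_le_range_mkM_sup_quadRel : (⊤ : Submodule ℤ (XStar g)) ≤ LinearMap.range (mkM g) ⊔ quadRel g := by
  intro x _
  induction x using Finsupp.induction_linear with
  | zero => exact Submodule.zero_mem _
  | add x y hx hy => exact Submodule.add_mem _ (hx Submodule.mem_top) (hy Submodule.mem_top)
  | single I b =>
    have : Finsupp.single I b = b • eps g I := by simp [eps]
    rw [this]
    exact Submodule.smul_mem _ b (eps_mem_range_mkM_sup_quadRel g I)

/-- **Proposition 5.1 holds** (kernel-proved): `ker(rec^*) = N₁` for `g ≥ 1`.  Proof as in the paper: `X^* = M + N₁` (every `ε_I`,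
by induction on `I`), `N₁ ⊆ N'` (`quadRel_le_Nprime`) and `M ∩ N' = 0` (Lemma 5.3). -/
theorem Proposition51_holds : Proposition51 := by
  intro g hg
  refine le_antisymm ?_ (quadRel_le_Nprime g)
  intro x hx
  obtain ⟨y, hy, z, hz, hyz⟩ :=
    Submodule.mem_sup.mp (top_le_range_mkM_sup_quadRel g (Submodule.mem_top (x := x)))
  obtain ⟨k, rfl⟩ := LinearMap.mem_range.mp hy
  have hzN : recStar g z = 0 := LinearMap.mem_ker.mp (quadRel_le_Nprime g hz)
  have hx' : recStar g x = 0 := LinearMap.mem_ker.mp hx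
  have hk : recStar g (mkM g k) = 0 := by
    rw [← hyz, map_add, hzN, add_zero] at hx'
    exact hx'
  obtain rfl := mkM_eq_zero_of_recStar_eq_zero g hg k hk
  rw [map_zero, zero_add] at hyz
  rw [← hyz]
  exact hz

end Prop51Proof

end GaoUllmo
end HodgeCM

end
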